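import Summits.QuantumFields.QCD.Theorems.SpectralDefectExtinctionChiralDescentSharedChiralItems

/-!
# `ChiralDescentOfPieces` — the split glue of route SpectralDefectExtinction (item stmt-QuantumFields-19237), proved

Strategist r1 decomposition (2026-08-17) of the deciding crux `ChiralDescent` (stmt-QuantumFields-17527) into the two
shared open-problem nodes `MassContinuation` (stmt-QuantumFields-18327) ∧ `ChiralTupleGapless` (stmt-QuantumFields-18328),
filed on the route as items (rev 13).  The glue item

  `ChiralDescentOfPieces : MassContinuation → ChiralTupleGapless → ChiralDescent`

is, through the definitional equalities `SpectralDefectExtinction.MassContinuation = QuarksAsStableAction.MassContinuation`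
and `SpectralDefectExtinction.ChiralTupleGapless = QuarksAsStableAction.ChiralTupleGapless` (same text, `rfl`), literally
the landed cross-route theorem
`Summit.QuantumFields.QCD.Cruxes.ChiralDescent.InfimumDescent.chiralDescent_of_massContinuation_of_chiralTupleGapless`
(p139859: infimum descent — the gapless tuple bounds the body up-set from below, mass continuation is its openness, the
re-pin at the infimum is chiral at zero and carries the body at every positive tuple).  Pure logic over `QCDOS.lean`;
standard axioms.
-/

namespace Summit.QuantumFields.QCD.Theorems

open Summit.QuantumFields.QCD

/-- **Item stmt-QuantumFields-19237 `SpectralDefectExtinction.ChiralDescentOfPieces` holds**: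
`MassContinuation → ChiralTupleGapless → ChiralDescent`, by the landed infimum-descent glue (p139859) read through the
definitional equalities `SpectralDefectExtinction.MassContinuation = QuarksAsStableAction.MassContinuation` and
`SpectralDefectExtinction.ChiralTupleGapless = QuarksAsStableAction.ChiralTupleGapless` (both `rfl`: same text). [folklore] -/
theorem chiralDescentOfPieces_proof : Theses.SpectralDefectExtinction.ChiralDescentOfPieces :=
  fun h₁ h₂ =>
    Cruxes.ChiralDescent.InfimumDescent.chiralDescent_of_massContinuation_of_chiralTupleGapless h₁ h₂

/-- The same glue with the route's own child decls displayed (the shape `C₁ → C₂ → C` of the split). [folklore] -/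
theorem chiralDescent_of_pieces :
    Theses.SpectralDefectExtinction.MassContinuation → Theses.SpectralDefectExtinction.ChiralTupleGapless →
      Theses.SpectralDefectExtinction.ChiralDescent :=
  chiralDescentOfPieces_proof

end Summit.QuantumFields.QCD.Theorems
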